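import Mathlib.Data.Nat.Choose.Central
import Literature.NumberTheory.DiophantineApproximation.PolylogHermitePade
import HarnessLib

/-!
# Type-I Hermite–Padé forms for `1, Li_s(1/N), Li_s(−1/N)` (`s ≤ w`) — vocabulary (the parity kernel)

Topic `Literature/NumberTheory/DiophantineApproximation`. David–Hirata-Kohno–Kawashima 2020, Thm 2.1,
at the TWO points `±1/N` (`K = ℚ`, `x = 0`, `m = 2`, `α = (1, −1)`, `β = N`): for every weight `w ≥ 1`
and every large integer `N` the `2w + 1` numbers `1, Li_s(1/N), Li_s(−1/N)` (`1 ≤ s ≤ w`) are linearly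
independent over `ℚ`. The tree proves the ONE-point case (`one_polylog_linearIndependent`,
`PolylogLinearIndependence.lean`); this family of files proves the two-point case by a PARITY reduction
to a one-point problem with the two shifts `0` and `½`:

  `Li_s(1/N) = 2^{−s} Li_s(y) + N Θ_s(y)`, `Li_s(−1/N) = 2^{−s} Li_s(y) − N Θ_s(y)`, `y = 1/N²`,

where `Θ_s(y) = ∑_{k ≥ 0} y^{k+1}/(2k+1)^s` (`oddPolylogSeries`), so the claim is the `ℚ`-linear
independence of `1, Li_s(y), Θ_s(y)` (`s ≤ w`) at `y = 1/M`, `M = N²` large. The type-I kernel is the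
numerator of the one-point kernel `R^{(w)}_n(u) = (u − wn + 1)_{wn}/(u+1)_{n+1}^w` (`PolylogPade.kernelW`)
placed over the Ball–Rivoal pole set in the doubled variable `t = 2u`:

  `K^{(w)}_n(u) = 4^{wn} (u − wn + 1)_{wn} / (2u + 1)_{n+1}^w`   (`kernelH w n u`),

a rational function of `t = 2u` with the poles `t = −1, …, −(n+1)` of multiplicity `w` and the EVEN roots
`t = 0, 2, …, 2wn − 2`. Summed over the naturals `u` (i.e. over even `t` only) it gives the form
`Λ^{(w)}_n(y) = ∑_{u ≥ 0} K^{(w)}_n(u) y^{u+1}` (`formH`), which is `O((4y)^{wn})` while — after the partial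
fraction expansion `K^{(w)}_n(u) = ∑_{p ≤ n} ∑_{o < w} c_{o,p}/(2u+p+1)^{o+1}` (`BallRivoal.pfEval n w c (2u)`)
— `2^w Λ^{(w)}_n(1/M)` is a linear form in `1, Li_{o+1}(1/M)` (odd pole index `p`, even denominators
`2u+p+1 = 2(u+1+p/2)`) and `Θ_{o+1}(1/M)` (even `p`, odd denominators `2(u+p/2)+1`) whose coefficients
(`coefLi`, `coefTh`, `constH`) are polynomials in `M` of degree `≤ n/2`; this ratio `wn : n/2` is what makes
Nesterenko's criterion close with `2w` irrationals. In `t` the kernel is the product of the `w` bricks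
`4^n (t/2 − (s+1)n + 1)_n/(t+1)_{n+1}` (`s < w`), whose residues `resP n s m` at `t = −m−1` are the
integers `(−1)^{n+m} C(n,m) E(m+1+2sn, n)` with `E(q, n) = 2^n q(q+2)⋯(q+2n−2)/n!` (`stepTwoBinom q n`, the
Taylor coefficients of `(1 − 4x)^{−q/2}`, natural numbers by the Pascal-type recursion
`E(q+2, n+1) = E(q, n+1) + 4 E(q+2, n)`), so `BallRivoal.exists_pf_prod` applies verbatim.

This file only fixes the VOCABULARY (definitions, no facts): `stepTwoBinom`, `resP`, `kernelH`,
`oddPolylogSeries`, `formH`, `coefLi`, `coefTh`, `constH`. The brick identities, the expansion, the series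
identity, the bounds and the independence theorems are proved in the sibling files
`PolylogTwoPointHermitePade*.lean` / `PolylogTwoPointLinearIndependence.lean`.

References: S. David, N. Hirata-Kohno, M. Kawashima, *Can polylogarithms at algebraic points be linearly
independent?*, Moscow J. Comb. Number Th. 9 (2020) 389–406, Thm 2.1 [DavidHirataKohnoKawashima2020];
E. M. Nikišin, Mat. Sb. 109 (1979); M. Hata, J. Math. Pures Appl. 69 (1990); T. Rivoal, C. R. Acad. Sci.
Paris 331 (2000), §2 (the brick mechanism).
-- TODO(general form): arbitrary pairwise distinct algebraic `α_1, …, α_m` and the thresholds `V > 0` of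
-- [DavidHirataKohnoKawashima2020, Thm 2.1]; here only `α = (1, −1)` over `ℚ`.
-/

noncomputable section

open Finset

namespace Literature.NumberTheory.DiophantineApproximation

namespace ParityPade

open Literature.NumberTheory.Transcendental

/-- The even-step binomial numbers `E(q, n) = 2^n · q (q+2) (q+4) ⋯ (q+2n−2) / n!`, the Taylor
coefficients of `(1 − 4x)^{−q/2} = ∑_n E(q, n) x^n` (`E(2a, n) = 4^n C(a+n−1, n)`, `E(1, n) = C(2n, n)`),
defined as natural numbers by the Pascal-type recursion `E(q+2, n+1) = E(q, n+1) + 4 E(q+2, n)`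
(from `(1−4x)^{−(q+2)/2} (1 − 4x) = (1−4x)^{−q/2}`) with `E(q, 0) = 1`, `E(0, n+1) = 0`,
`E(1, n) = C(2n, n)`. They are the residue numerators of the parity bricks at the odd and even poles.
[folklore] -/
def stepTwoBinom : ℕ → ℕ → ℕ
  | _, 0 => 1
  | 0, _ + 1 => 0
  | 1, n + 1 => Nat.centralBinom (n + 1)
  | q + 2, n + 1 => stepTwoBinom q (n + 1) + 4 * stepTwoBinom (q + 2) n
termination_by q n => (q, n)

/-- The integer residues of the parity brick `s`,
`4^n (t/2 − (s+1)n + 1)_n / (t+1)_{n+1} = ∑_{m ≤ n} (resP n s m)/(t + m + 1)`: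
`resP n s m = (−1)^{n+m} C(n, m) E(m + 1 + 2sn, n)` (Lagrange division at the nodes `−1, …, −(n+1)`;
the numerator at `t = −m−1` is `(−1)^n 2^n ∏_{i<n} (m + 1 + 2sn + 2i) = (−1)^n n! E(m+1+2sn, n)`).
[cite: DavidHirataKohnoKawashima2020, Thm 2.1] -/
def resP (n s m : ℕ) : ℤ :=
  (-1) ^ (n + m) * (n.choose m : ℤ) * (stepTwoBinom (m + 1 + 2 * s * n) n : ℤ)

/-- The weight-`w` PARITY kernel `K^{(w)}_n(u) = 4^{wn} (u − wn + 1)_{wn} / (2u + 1)_{n+1}^w`: the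
numerator of the one-point kernel `PolylogPade.kernelW w n` over the Ball–Rivoal denominator in the doubled
variable `t = 2u` (poles `t = −1, …, −(n+1)`, even roots `t = 0, 2, …, 2wn − 2`), a rational function of
`u : ℚ` (junk value `x/0 = 0` at the poles `u = −1/2, −1, …, −(n+1)/2`, never used).
[cite: DavidHirataKohnoKawashima2020, Thm 2.1] -/
def kernelH (w n : ℕ) (u : ℚ) : ℚ :=
  4 ^ (w * n) * BallRivoal.poch (u - w * n + 1) (w * n) / BallRivoal.poch (2 * u + 1) (n + 1) ^ w

/-- The odd polylogarithm-type series `Θ_s(y) = ∑_{k ≥ 0} y^{k+1}/(2k+1)^s` (absolutely convergent for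
`|y| < 1`); at `y = 1/N²` it is `N^{−1} ∑_{k ≥ 0} N^{−(2k+1)}/(2k+1)^s`, the odd part of `Li_s(1/N)`
divided by `N`, so that `Li_s(±1/N) = 2^{−s} Li_s(1/N²) ± N Θ_s(1/N²)`
(`Li_s = DilogPade.polylogSeries s`). [folklore] -/
def oddPolylogSeries (s : ℕ) (y : ℝ) : ℝ := ∑' k : ℕ, y ^ (k + 1) / (2 * (k : ℝ) + 1) ^ s

/-- The weight-`w` parity form `Λ^{(w)}_n(y) = ∑_{u ≥ 0} K^{(w)}_n(u) y^{u+1}` (a real `tsum` over the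
naturals `u`, i.e. over the EVEN values of `t = 2u`; absolutely convergent for `|y| < 1` since
`0 ≤ K^{(w)}_n(u) ≤ 4^{wn}` at the naturals). [cite: DavidHirataKohnoKawashima2020, Thm 2.1] -/
def formH (w n : ℕ) (y : ℝ) : ℝ := ∑' u : ℕ, (kernelH w n u : ℝ) * y ^ (u + 1)

/-- The coefficient of `Li_{o+1}(1/M)` in `2^w Λ^{(w)}_n(1/M)` attached to partial-fraction data `c`
(coefficient `c o p` of `1/(t+p+1)^{o+1}`, `t = 2u`): the ODD pole indices `p` contribute, since
`2u + p + 1 = 2(u + 1 + p/2)` and `∑_u M^{−u−1}/(u+1+i)^s = M^i (Li_s(1/M) − ∑_{k<i} M^{−k−1}/(k+1)^s)`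
(`i = p/2`, natural division): `∑_{p ≤ n, p odd} c_{o,p} 2^{w−1−o} M^{p/2}`. [folklore] -/
def coefLi (n w : ℕ) (c : ℕ → ℕ → ℚ) (M o : ℕ) : ℚ :=
  ∑ p ∈ range (n + 1), if Odd p then c o p * 2 ^ (w - 1 - o) * (M : ℚ) ^ (p / 2) else 0

/-- The coefficient of `Θ_{o+1}(1/M)` in `2^w Λ^{(w)}_n(1/M)` attached to partial-fraction data `c`: the
EVEN pole indices `p` contribute, since `2u + p + 1 = 2(u + p/2) + 1` and
`∑_u M^{−u−1}/(2(u+i)+1)^s = M^i (Θ_s(1/M) − ∑_{k<i} M^{−k−1}/(2k+1)^s)` (`i = p/2`):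
`∑_{p ≤ n, p even} c_{o,p} 2^w M^{p/2}`. [folklore] -/
def coefTh (n w : ℕ) (c : ℕ → ℕ → ℚ) (M o : ℕ) : ℚ :=
  ∑ p ∈ range (n + 1), if Even p then c o p * 2 ^ w * (M : ℚ) ^ (p / 2) else 0

/-- The constant term of `2^w Λ^{(w)}_n(1/M)` attached to partial-fraction data `c` (the finite
remainders of the two shift identities, see `coefLi`, `coefTh`):
`−∑_{o<w} ∑_{p≤n} c_{o,p} · (2^{w−1−o} ∑_{k<p/2} M^{p/2}/(M^{k+1}(k+1)^{o+1}))` for odd `p`,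
`−∑_{o<w} ∑_{p≤n} c_{o,p} · (2^w ∑_{k<p/2} M^{p/2}/(M^{k+1}(2k+1)^{o+1}))` for even `p`. [folklore] -/
def constH (n w : ℕ) (c : ℕ → ℕ → ℚ) (M : ℕ) : ℚ :=
  -∑ o ∈ range w, ∑ p ∈ range (n + 1), c o p *
    (if Odd p then
      (2 : ℚ) ^ (w - 1 - o) *
        ∑ k ∈ range (p / 2), (M : ℚ) ^ (p / 2) / ((M : ℚ) ^ (k + 1) * ((k : ℚ) + 1) ^ (o + 1))
     else
      (2 : ℚ) ^ w *
        ∑ k ∈ range (p / 2), (M : ℚ) ^ (p / 2) / ((M : ℚ) ^ (k + 1) * (2 * (k : ℚ) + 1) ^ (o + 1)))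

/-- The recursion's first boundary value: `E(q, 0) = 1`. [folklore] -/
theorem stepTwoBinom_zero_right (q : ℕ) : stepTwoBinom q 0 = 1 := by
  rcases q with _ | _ | q <;> simp [stepTwoBinom]

/-- The recursion's second boundary value: `E(0, n+1) = 0` (the factor `q = 0` of the product).
[folklore] -/
theorem stepTwoBinom_zero_succ (n : ℕ) : stepTwoBinom 0 (n + 1) = 0 := by
  simp [stepTwoBinom]

/-- The recursion's third boundary value: `E(1, n) = C(2n, n)` (`2^n (2n−1)!!/n!`). [folklore] -/
theorem stepTwoBinom_one (n : ℕ) : stepTwoBinom 1 n = Nat.centralBinom n := by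
  rcases n with _ | n <;> simp [stepTwoBinom]

/-- The Pascal-type recursion `E(q+2, n+1) = E(q, n+1) + 4 E(q+2, n)`. [folklore] -/
theorem stepTwoBinom_succ_succ (q n : ℕ) :
    stepTwoBinom (q + 2) (n + 1) = stepTwoBinom q (n + 1) + 4 * stepTwoBinom (q + 2) n := by
  simp [stepTwoBinom]

end ParityPade

end Literature.NumberTheory.DiophantineApproximation
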